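import Mathlib
import HarnessLib
import Summits.CriticalPhenomena.PercolationContinuityZ3.Theses.PercTreeValue
import Summits.CriticalPhenomena.PercolationContinuityZ3.Theorems.PercTreeValueTetrahedronDisjointCoexistenceStubRestrictSymm
import Literature.Probability.Percolation.BondPercolationSymmetry
import Literature.Probability.Percolation.LatticeSymmetry
import Literature.Probability.LatticeModels.LatticeGraphProofs

/-!
# `stub_mirrorRestrict` of line `Sketch` (crux `TetrahedronDisjointCoexistence`,
# stmt-CriticalPhenomena-7798): the rotoreflection `φ_r` for restricted connections,
# roof height as a free parameter

Registered stub `stub_mirrorRestrict` of the lead's skeleton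
`Cruxes/TetrahedronDisjointCoexistence/Lines/Sketch.lean`, landed DEF-FREE over tree
declarations.

With `a_r = (r,r,0)`, `b_r = (r,0,r)`, `c_r = (0,r,r)` in `ℤ³` and a roof height `h : ℤ`:
`P(b_r ↔ c_r in {x | h ≤ x₂}) = P(0 ↔ a_r in {x | x₂ ≤ r − h})` for
`P = bondPercolation (zdGraph 3) p`, every `p`.

Proof. Identical to the landed `stub_restrictSymm` (file
`PercTreeValueTetrahedronDisjointCoexistenceStubRestrictSymm.lean`), with the pair of half-spaces
replaced by `{x | x₂ ≤ r − h}` and its image `{x | h ≤ x₂}`: the rotoreflection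
`φ_r(x) = (r − x₁, x₀, r − x₂)` is an automorphism of the nearest-neighbour graph `ℤ³`
(`zdGraph_adj_iff_norm_holds`), with `φ_r 0 = b_r`, `φ_r a_r = c_r` and `(φ_r x)₂ = r − x₂`, so
`φ_r '' {x | x₂ ≤ r − h} = {x | h ≤ x₂}`. Bond percolation is invariant under graph automorphisms
(`bondPercolation_real_preimage_relabel_iso`), and `ω ↦ φ '' ω` pulls the restricted connection
event `{φ x ↔ φ y in φ(S)}` back to `{x ↔ y in S}` (`restrictSymm_preimage_relabel_openConnIn`).
-/

noncomputable section

namespace Summit.CriticalPhenomena.PercolationContinuityZ3.Theorems.TetrahedronDisjointCoexistence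

open MeasureTheory
open Literature.Probability.Percolation Literature.Probability.LatticeModels

/-- **Restricted pair symmetry, roof height as a parameter.** With `a_r = (r,r,0)`,
`b_r = (r,0,r)`, `c_r = (0,r,r)` and `h : ℤ`:
`P(b_r ↔ c_r in {x | h ≤ x₂}) = P(0 ↔ a_r in {x | x₂ ≤ r − h})` for
`P = bondPercolation (zdGraph 3) p`, by the lattice automorphism `φ_r(x) = (r − x₁, x₀, r − x₂)`
(`φ_r 0 = b_r`, `φ_r a_r = c_r`, `φ_r '' {x | x₂ ≤ r − h} = {x | h ≤ x₂}`), the transport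
`(φ_r '' ·)⁻¹ {φ_r x ↔ φ_r y in φ_r(S)} = {x ↔ y in S}`
(`restrictSymm_preimage_relabel_openConnIn`) and the automorphism invariance of bond percolation
(`bondPercolation_real_preimage_relabel_iso`). -/
theorem stub_mirrorRestrict (p : unitInterval) (r : ℕ) (h : ℤ) :
    (bondPercolation (zdGraph 3) p).real
        (openConnIn {x : Site 3 | h ≤ x 2} (![(r : ℤ), 0, (r : ℤ)] : Site 3) ![0, (r : ℤ), (r : ℤ)]) =
      (bondPercolation (zdGraph 3) p).real
        (openConnIn {x : Site 3 | x 2 ≤ (r : ℤ) - h} (0 : Site 3) ![(r : ℤ), (r : ℤ), 0]) := by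
  -- `ℓ¹` characterisation of adjacency in `ℤ³`
  have hadj : ∀ x y : Site 3, (zdGraph 3).Adj x y ↔ ∑ i, |x i - y i| = 1 :=
    zdGraph_adj_iff_norm_holds
  have habs : ∀ s t : ℤ, |(r : ℤ) - s - ((r : ℤ) - t)| = |s - t| := by
    intro s t
    rw [abs_sub_comm]
    congr 1
    ring
  -- the rotoreflection `φ_r(x) = (r - x₁, x₀, r - x₂)`, an automorphism of `ℤ³`
  let φ : zdGraph 3 ≃g zdGraph 3 :=
    { toFun := fun x => ![(r : ℤ) - x 1, x 0, (r : ℤ) - x 2]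
      invFun := fun y => ![y 1, (r : ℤ) - y 0, (r : ℤ) - y 2]
      left_inv := fun x => by
        funext i
        fin_cases i <;> simp
      right_inv := fun y => by
        funext i
        fin_cases i <;> simp
      map_rel_iff' := fun {a b} => by
        simp only [Equiv.coe_fn_mk, hadj, Fin.sum_univ_three, Matrix.cons_val_zero,
          Matrix.cons_val_one, Matrix.head_cons, Matrix.cons_val_two, Matrix.tail_cons, habs]
        constructor <;> intro hab <;> linarith }
  have hφ : ∀ x : Site 3, φ x = ![(r : ℤ) - x 1, x 0, (r : ℤ) - x 2] := fun x => rfl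
  have hφs : ∀ y : Site 3, φ.symm y = ![y 1, (r : ℤ) - y 0, (r : ℤ) - y 2] := fun y => rfl
  have hφ0 : φ 0 = ![(r : ℤ), 0, (r : ℤ)] := by
    rw [hφ]
    funext i
    fin_cases i <;> simp
  have hφa : φ ![(r : ℤ), (r : ℤ), 0] = ![0, (r : ℤ), (r : ℤ)] := by
    rw [hφ]
    funext i
    fin_cases i <;> simp
  -- `φ_r '' {x | x₂ ≤ r - h} = {x | h ≤ x₂}`
  have hU : ⇑φ '' {x : Site 3 | x 2 ≤ (r : ℤ) - h} = {x : Site 3 | h ≤ x 2} := by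
    ext y
    constructor
    · rintro ⟨x, hx, rfl⟩
      simp only [Set.mem_setOf_eq, hφ, Matrix.cons_val_two, Matrix.tail_cons, Matrix.head_cons]
        at hx ⊢
      omega
    · intro hy
      refine ⟨φ.symm y, ?_, φ.apply_symm_apply y⟩
      simp only [Set.mem_setOf_eq, hφs, Matrix.cons_val_two, Matrix.tail_cons, Matrix.head_cons]
        at hy ⊢
      omega
  have h1 := restrictSymm_preimage_relabel_openConnIn φ.toEquiv
    {x : Site 3 | x 2 ≤ (r : ℤ) - h} (0 : Site 3) ![(r : ℤ), (r : ℤ), 0]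
  rw [RelIso.coe_fn_toEquiv, hU, hφ0, hφa] at h1
  rw [← h1]
  exact (bondPercolation_real_preimage_relabel_iso φ p _).symm

end Summit.CriticalPhenomena.PercolationContinuityZ3.Theorems.TetrahedronDisjointCoexistence

end
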